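import Literature.NumberTheory.Sieve.RoughNumbersBuchstabMainSum
import HarnessLib

/-!
# The main sum of the Buchstab iteration for a general `C¹` weight

Topic `Literature/NumberTheory/Sieve`. Everything here is PROVED (no definitions, no named facts).
The files `RoughNumbersBuchstabPrimeSum*.lean`, `RoughNumbersBuchstabMainSum.lean` evaluate
`∑_{y ≤ p < z} x ω(log x/log p − 1)/(p log p)` for Buchstab's function `ω` only (using `|ω| ≤ 1`,
`|ω'| ≤ 1/4` and the integral equation of `ω`). Here the same computation is carried out for an
ARBITRARY weight `σ` which is `C¹` on the range of `s = log x/log t − 1` that actually occurs,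
`s ∈ (k − 1, 2k + 1]` for `t ∈ [a, b]` (from `k log b < log x ≤ 2(k + 1) log a`), the bounds
`|σ| ≤ B`, `|σ'| ≤ B'` there being explicit hypotheses. This is the form in which the estimate is
iterated (Harman §1.4: the weights `ω(u − 1)/u`, Alladi-type cell densities `I_{i+1}(s)/s`,
Lichtman §6):

* `integral_weight_comp_logRatio_eq` — the substitution `s = log x/log t − 1`:
  `∫_y^z x σ(log x/log t − 1) dt/(t log² t) = (x/log x) ∫_{k−1}^{u−1} σ` (`log z = (log x)/k`,
  `u = log x/log y ≥ k > 0`);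
* `abs_sum_weight_sub_integral_le` — Abel summation through `ϑ`
  (`abs_sum_sub_integral_le_of_weight_bounds`) for `f(t) = x σ(log x/log t − 1)/(t log² t)`,
  which has `|f| ≤ B x/(t log² t)`, `|f'| ≤ (2(k + 1)B' + 3B) x/(t² log² t)` on `[a, b]`:
  `|∑_{⌊a⌋ < p ≤ ⌊b⌋} x σ(log x/log p − 1)/(p log p) − ∫_a^b f| ≤ (2 + 3K) C₀ (B + 1) x/log² a`,
  `K = 2(k + 1)B' + 3B`;
* `abs_sum_weight_sub_main_le` — the two combined, the endpoints of the integral being moved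
  from `[a, b]` to `[y, z]` (`abs_integral_sub_integral_le_two_mul_of_shift`):
  `|∑_{⌊a⌋ < p ≤ ⌊b⌋} x σ(log x/log p − 1)/(p log p) − (x/log x) ∫_{k−1}^{u−1} σ|`
  `≤ ((2 + 3K) C₀ (B + 1) + 2B) x/log² a`.

With `σ = ω`, `B = 1`, `B' = 1/4` these are the estimates of the `ω`-files (with slightly weaker
constants). Deliberately NOT here: any property of a specific weight.

## References

* J. D. Lichtman, arXiv:2109.02851, §6.1, Lemma 6.1. [Lichtman2025LinearSieve]
* G. Harman, *Prime-Detecting Sieves* (2007), §1.4 (1.4.14)–(1.4.16), App. A.2. [Harman2007]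
-/

open Finset Real MeasureTheory Set intervalIntegral
open scoped Chebyshev

noncomputable section

namespace Literature.NumberTheory.Sieve

/-! ### The main term: substitution `s = log x/log t − 1` -/

/-- **The main term of the Buchstab iteration for a general weight.** For `k > 0`, `1 < y ≤ z`
with `log z = (log x)/k`, `u = log x/log y ≥ k` and `σ` continuous on `[k − 1, u − 1]`:
`∫_y^z x σ(log x/log t − 1)/(t log² t) dt = (x/log x) ∫_{k−1}^{u−1} σ(s) ds`
(substitute `s = log x/log t − 1`, `ds = −log x dt/(t log² t)`; Harman §1.4, "the change of
variables `v = (log x)/(log y)`" in the derivation of (1.4.14)–(1.4.16)).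
[cite: Harman2007, §1.4] -/
theorem integral_weight_comp_logRatio_eq {σ : ℝ → ℝ} {x y z k : ℝ} (hk : 0 < k) (hy : 1 < y)
    (hyz : y ≤ z) (hz : Real.log z = Real.log x / k) (hu : k ≤ Real.log x / Real.log y)
    (hσc : ContinuousOn σ (Set.Icc (k - 1) (Real.log x / Real.log y - 1))) :
    ∫ t in y..z, x * σ (Real.log x / Real.log t - 1) / (t * Real.log t ^ 2) =
      x / Real.log x * ∫ s in (k - 1)..(Real.log x / Real.log y - 1), σ s := by
  set u : ℝ := Real.log x / Real.log y with hu_def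
  set φ : ℝ → ℝ := fun s => Real.log x / Real.log s - 1 with hφ
  set φ' : ℝ → ℝ := fun s => -Real.log x / (s * Real.log s ^ 2) with hφ'
  have hly : 0 < Real.log y := Real.log_pos hy
  have hLx : 0 < Real.log x := (div_pos_iff_of_pos_right hly).mp (hk.trans_le hu)
  have huIcc : uIcc y z = Icc y z := uIcc_of_le hyz
  have hmem : ∀ t ∈ Icc y z, 1 < t ∧ 0 < Real.log t ∧ k - 1 ≤ φ t ∧ φ t ≤ u - 1 := by
    intro t ht
    have ht1 : 1 < t := hy.trans_le ht.1
    have hlt : 0 < Real.log t := Real.log_pos ht1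
    refine ⟨ht1, hlt, ?_, ?_⟩
    · have hz1 : Real.log t ≤ Real.log z := Real.log_le_log (by linarith) ht.2
      have : k ≤ Real.log x / Real.log t := by
        rw [le_div_iff₀ hlt]
        calc k * Real.log t ≤ k * Real.log z := by gcongr
          _ = Real.log x := by rw [hz]; field_simp
      simp only [hφ]; linarith
    · have hy1 : Real.log y ≤ Real.log t := Real.log_le_log (by linarith) ht.1
      have : Real.log x / Real.log t ≤ u := div_le_div_of_nonneg_left hLx.le hly hy1
      simp only [hφ]; linarith
  -- the integrand is `(−x/log x) · (σ ∘ φ) · φ'`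
  have hcongr : ∫ t in y..z, x * σ (Real.log x / Real.log t - 1) / (t * Real.log t ^ 2) =
      ∫ t in y..z, (-x / Real.log x) * ((σ ∘ φ) t * φ' t) := by
    refine intervalIntegral.integral_congr fun t ht => ?_
    obtain ⟨ht1, hlt, -⟩ := hmem t (huIcc ▸ ht)
    have ht0 : t ≠ 0 := by positivity
    simp only [Function.comp, hφ, hφ']
    field_simp
  have hderiv : ∀ t ∈ uIcc y z, HasDerivAt φ (φ' t) t := fun t ht =>
    hasDerivAt_logRatio_sub_one x (hmem t (huIcc ▸ ht)).1
  have hcont : ContinuousOn φ' (uIcc y z) := by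
    rw [huIcc]
    intro t ht
    obtain ⟨ht1, hlt, -⟩ := hmem t ht
    have h1 : t ≠ 0 := by positivity
    have h2 : t * Real.log t ^ 2 ≠ 0 := mul_ne_zero h1 (pow_ne_zero 2 hlt.ne')
    refine ContinuousAt.continuousWithinAt ?_
    simp only [hφ']
    fun_prop (disch := assumption)
  have himage : φ '' uIcc y z ⊆ Icc (k - 1) (u - 1) := by
    rw [huIcc]
    rintro _ ⟨t, ht, rfl⟩
    exact ⟨(hmem t ht).2.2.1, (hmem t ht).2.2.2⟩
  have hsubst := intervalIntegral.integral_comp_mul_deriv' hderiv hcont (hσc.mono himage)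
  have hφy : φ y = u - 1 := by simp only [hφ, hu_def]
  have hφz : φ z = k - 1 := by simp only [hφ]; rw [hz]; field_simp
  rw [hcongr, intervalIntegral.integral_const_mul, hsubst, hφy, hφz,
    intervalIntegral.integral_symm (k - 1) (u - 1)]
  ring

/-! ### Abel summation for the weight `x σ(log x/log t − 1)/(t log² t)` -/

/-- For `t ∈ [a, b]` with `e ≤ a`, `k log b < log x ≤ 2(k + 1) log a`: `t > 0`, `log t ≥ 1` and
`k − 1 < log x/log t − 1 ≤ 2k + 1`. [folklore] -/
private theorem aux_mem_Ioc {k : ℕ} {x a b t : ℝ} (ha : Real.exp 1 ≤ a)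
    (hbx : k * Real.log b < Real.log x) (hxa : Real.log x ≤ 2 * (k + 1) * Real.log a)
    (ht : t ∈ Icc a b) :
    0 < t ∧ 1 ≤ Real.log t ∧ (k : ℝ) - 1 < Real.log x / Real.log t - 1 ∧
      Real.log x / Real.log t - 1 ≤ 2 * k + 1 := by
  have ha0 : 0 < a := (Real.exp_pos 1).trans_le ha
  have ht0 : 0 < t := ha0.trans_le ht.1
  have hlt : 1 ≤ Real.log t := by rw [Real.le_log_iff_exp_le ht0]; exact ha.trans ht.1
  have hltb : Real.log t ≤ Real.log b := Real.log_le_log ht0 ht.2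
  have hlat : Real.log a ≤ Real.log t := Real.log_le_log ha0 ht.1
  have hl0 : 0 < Real.log t := by linarith
  refine ⟨ht0, hlt, ?_, ?_⟩
  · rw [sub_lt_sub_iff_right, lt_div_iff₀ hl0]
    calc (k : ℝ) * Real.log t ≤ k * Real.log b := by gcongr
      _ < Real.log x := hbx
  · rw [sub_le_iff_le_add, div_le_iff₀ hl0]
    calc Real.log x ≤ 2 * (k + 1) * Real.log a := hxa
      _ ≤ 2 * (k + 1) * Real.log t := by gcongr
      _ = (2 * k + 1 + 1) * Real.log t := by ring

/-- **The prime sum of the Buchstab iteration for a general `C¹` weight.** Let `e ≤ a ≤ b`,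
`k log b < log x ≤ 2(k + 1) log a`, `log b ≤ 3 log a`, `x ≥ 0`, `|ϑ(t) − t| ≤ C₀ t/log² t`
(`t ≥ 2`), and let `σ` be differentiable with derivative `σ'` continuous on `(k − 1, 2k + 1]`,
`|σ| ≤ B` and `|σ'| ≤ B'` there (`B, B' ≥ 0`). Then
`|∑_{⌊a⌋ < p ≤ ⌊b⌋} x σ(log x/log p − 1)/(p log p) − ∫_a^b x σ(log x/log t − 1) dt/(t log² t)|`
`≤ (2 + 3(2(k + 1)B' + 3B)) C₀ (B + 1) x/log² a`
(the weight `f(t) = x σ(log x/log t − 1)/(t log² t)` has `|f| ≤ B x/(t log² t)` and, by the chain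
rule with `d/dt (log x/log t − 1) = −log x/(t log² t)` and `log x ≤ 2(k + 1) log t`,
`|f'| ≤ (2(k + 1)B' + 3B) x/(t² log² t)`; then `abs_sum_sub_integral_le_of_weight_bounds`). This is
the partial summation of Lichtman's Lemma 6.1 / Harman (1.4.16) with `ω` replaced by `σ`.
[cite: Lichtman2025LinearSieve, Lemma 6.1] -/
theorem abs_sum_weight_sub_integral_le {σ σ' : ℝ → ℝ} {k : ℕ} {x a b C₀ B B' : ℝ} (hC₀ : 0 ≤ C₀)
    (hE : ∀ t : ℝ, 2 ≤ t → |θ t - t| ≤ C₀ * t / Real.log t ^ 2)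
    (ha : Real.exp 1 ≤ a) (hab : a ≤ b) (hbx : k * Real.log b < Real.log x)
    (hxa : Real.log x ≤ 2 * (k + 1) * Real.log a) (hba : Real.log b ≤ 3 * Real.log a) (hx : 0 ≤ x)
    (hB : 0 ≤ B) (hB' : 0 ≤ B')
    (hσ : ∀ s : ℝ, (k : ℝ) - 1 < s → s ≤ 2 * k + 1 → HasDerivAt σ (σ' s) s)
    (hσ'c : ContinuousOn σ' (Set.Ioc ((k : ℝ) - 1) (2 * k + 1)))
    (hσb : ∀ s : ℝ, (k : ℝ) - 1 < s → s ≤ 2 * k + 1 → |σ s| ≤ B)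
    (hσ'b : ∀ s : ℝ, (k : ℝ) - 1 < s → s ≤ 2 * k + 1 → |σ' s| ≤ B') :
    |∑ p ∈ (Finset.Ioc ⌊a⌋₊ ⌊b⌋₊).filter Nat.Prime,
        x * σ (Real.log x / Real.log p - 1) / (p * Real.log p) -
      ∫ t in a..b, x * σ (Real.log x / Real.log t - 1) / (t * Real.log t ^ 2)| ≤
      (2 + 3 * (2 * (k + 1) * B' + 3 * B)) * C₀ * ((B + 1) * x) / Real.log a ^ 2 := by
  have ha0 : 0 < a := (Real.exp_pos 1).trans_le ha
  have hk0 : (0 : ℝ) ≤ k := Nat.cast_nonneg k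
  have hL0 : 0 ≤ Real.log x := by
    obtain ⟨-, hla, h2, -⟩ := aux_mem_Ioc ha hbx hxa ⟨le_rfl, hab⟩
    have : 0 < Real.log x / Real.log a := by linarith
    exact ((div_pos_iff_of_pos_right (by linarith)).mp this).le
  -- the weight and its derivative
  set f : ℝ → ℝ := fun t => x * σ (Real.log x / Real.log t - 1) / (t * Real.log t ^ 2)
    with hf_def
  set f' : ℝ → ℝ := fun t =>
    (x * (σ' (Real.log x / Real.log t - 1) * (-Real.log x / (t * Real.log t ^ 2))) *
        (t * Real.log t ^ 2) -
      x * σ (Real.log x / Real.log t - 1) * (Real.log t ^ 2 + 2 * Real.log t)) /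
    (t * Real.log t ^ 2) ^ 2 with hf'_def
  have hf : ∀ t ∈ Icc a b, HasDerivAt f (f' t) t := by
    intro t ht
    obtain ⟨ht0, hlt, hφ1, hφ2⟩ := aux_mem_Ioc ha hbx hxa ht
    have ht1 : 1 < t := lt_of_lt_of_le (by linarith [Real.add_one_le_exp (1 : ℝ)]) (ha.trans ht.1)
    have hl0 : Real.log t ≠ 0 := by linarith
    have hden0 : t * Real.log t ^ 2 ≠ 0 := mul_ne_zero ht0.ne' (pow_ne_zero 2 hl0)
    have hcomp := (hσ _ hφ1 hφ2).comp t (hasDerivAt_logRatio_sub_one x ht1)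
    have hden := (hasDerivAt_id' t).fun_mul ((Real.hasDerivAt_log ht0.ne').fun_pow 2)
    refine ((hcomp.const_mul x).fun_div hden hden0).congr_deriv ?_
    have ht0' : t ≠ 0 := ht0.ne'
    rw [hf'_def]
    simp only [Function.comp, Nat.cast_ofNat]
    rw [show (2 : ℕ) - 1 = 1 from rfl, pow_one]
    field_simp
  have hf'c : ContinuousOn f' (Icc a b) := by
    intro t ht
    obtain ⟨ht0, hlt, hφ1, hφ2⟩ := aux_mem_Ioc ha hbx hxa ht
    have h1 : t ≠ 0 := ht0.ne'
    have hl0 : Real.log t ≠ 0 := by linarith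
    have h3 : t * Real.log t ^ 2 ≠ 0 := mul_ne_zero h1 (pow_ne_zero 2 hl0)
    have h2 : (t * Real.log t ^ 2) ^ 2 ≠ 0 := pow_ne_zero 2 h3
    have hφc : ContinuousAt (fun y : ℝ => Real.log x / Real.log y - 1) t := by
      fun_prop (disch := assumption)
    -- `σ` is continuous at `φ t` (it is differentiable there); `σ'` is continuous within
    -- `(k − 1, 2k + 1]` at `φ t`, and `φ` maps `[a, b]` into this interval
    have hA : ContinuousAt (fun y : ℝ => σ (Real.log x / Real.log y - 1)) t :=
      (hσ _ hφ1 hφ2).continuousAt.comp (f := fun y : ℝ => Real.log x / Real.log y - 1) hφc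
    have hA' : ContinuousWithinAt (fun y : ℝ => σ' (Real.log x / Real.log y - 1)) (Icc a b) t :=
      (hσ'c _ ⟨hφ1, hφ2⟩).comp (f := fun y : ℝ => Real.log x / Real.log y - 1)
        hφc.continuousWithinAt fun y hy =>
          ⟨(aux_mem_Ioc ha hbx hxa hy).2.2.1, (aux_mem_Ioc ha hbx hxa hy).2.2.2⟩
    have hC : ContinuousAt (fun y : ℝ => -Real.log x / (y * Real.log y ^ 2)) t := by
      fun_prop (disch := assumption)
    have hD : ContinuousAt (fun y : ℝ => y * Real.log y ^ 2) t := by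
      fun_prop (disch := assumption)
    have hF : ContinuousAt (fun y : ℝ => Real.log y ^ 2 + 2 * Real.log y) t := by
      fun_prop (disch := assumption)
    rw [hf'_def]
    exact (((continuousWithinAt_const.mul (hA'.mul hC.continuousWithinAt)).mul
      hD.continuousWithinAt).sub ((continuousWithinAt_const.mul hA.continuousWithinAt).mul
      hF.continuousWithinAt)).div (hD.pow 2).continuousWithinAt h2
  -- the bounds `|f| ≤ (B + 1) x/(t log² t)`, `|f'| ≤ (2(k + 1)B' + 3B)(B + 1) x/(t² log² t)`
  have hxB : x ≤ (B + 1) * x := by nlinarith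
  have hfb : ∀ t ∈ Icc a b, |f t| ≤ (B + 1) * x / (t * Real.log t ^ 2) := by
    intro t ht
    obtain ⟨ht0, hlt, hφ1, hφ2⟩ := aux_mem_Ioc ha hbx hxa ht
    have hσle := hσb _ hφ1 hφ2
    rw [hf_def]
    simp only
    rw [abs_div, abs_mul, abs_of_nonneg hx, abs_of_pos (by positivity : 0 < t * Real.log t ^ 2),
      div_le_div_iff_of_pos_right (by positivity)]
    calc x * |σ (Real.log x / Real.log t - 1)| ≤ x * B := by gcongr
      _ = (B + 1) * x - x := by ring
      _ ≤ (B + 1) * x := by linarith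
  have hf'b : ∀ t ∈ Icc a b,
      |f' t| ≤ (2 * (k + 1) * B' + 3 * B) * ((B + 1) * x) / (t ^ 2 * Real.log t ^ 2) := by
    intro t ht
    obtain ⟨ht0, hlt, hφ1, hφ2⟩ := aux_mem_Ioc ha hbx hxa ht
    have hlat : Real.log a ≤ Real.log t := Real.log_le_log ha0 ht.1
    set L := Real.log x with hL
    have hLt : L ≤ 2 * (k + 1) * Real.log t := hxa.trans (by gcongr)
    set ℓ := Real.log t with hℓ
    set φt := L / ℓ - 1 with hφt
    have hden_pos : 0 < t * ℓ ^ 2 := by positivity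
    have hσ'le : |σ' φt| ≤ B' := hσ'b _ hφ1 hφ2
    have hσle : |σ φt| ≤ B := hσb _ hφ1 hφ2
    rw [hf'_def]
    simp only
    rw [abs_div, abs_of_pos (by positivity : (0 : ℝ) < (t * ℓ ^ 2) ^ 2),
      div_le_div_iff₀ (by positivity) (by positivity)]
    -- the numerator is at most `x (B' L + B (ℓ² + 2ℓ)) ≤ x (2(k + 1)B' + 3B) ℓ²`
    have h1 : |x * (σ' φt * (-L / (t * ℓ ^ 2))) * (t * ℓ ^ 2)| ≤ x * (B' * L) := by
      rw [abs_mul, abs_mul, abs_mul, abs_of_nonneg hx, abs_of_pos hden_pos,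
        show |-L / (t * ℓ ^ 2)| = L / (t * ℓ ^ 2) by
          rw [neg_div, abs_neg, abs_of_nonneg (by positivity)]]
      calc x * (|σ' φt| * (L / (t * ℓ ^ 2))) * (t * ℓ ^ 2) = x * (|σ' φt| * L) := by field_simp
        _ ≤ x * (B' * L) := by gcongr
    have h2 : |x * σ φt * (ℓ ^ 2 + 2 * ℓ)| ≤ x * (B * (ℓ ^ 2 + 2 * ℓ)) := by
      rw [abs_mul, abs_mul, abs_of_nonneg hx, abs_of_pos (by positivity : 0 < ℓ ^ 2 + 2 * ℓ)]
      calc x * |σ φt| * (ℓ ^ 2 + 2 * ℓ) ≤ x * B * (ℓ ^ 2 + 2 * ℓ) := by gcongr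
        _ = _ := by ring
    have hnum : |x * (σ' φt * (-L / (t * ℓ ^ 2))) * (t * ℓ ^ 2) - x * σ φt * (ℓ ^ 2 + 2 * ℓ)| ≤
        x * (B' * L + B * (ℓ ^ 2 + 2 * ℓ)) := by
      refine (abs_sub _ _).trans ?_
      calc _ ≤ x * (B' * L) + x * (B * (ℓ ^ 2 + 2 * ℓ)) := add_le_add h1 h2
        _ = _ := by ring
    have hkey : B' * L + B * (ℓ ^ 2 + 2 * ℓ) ≤ (2 * (k + 1) * B' + 3 * B) * ℓ ^ 2 := by
      have hl2 : ℓ ≤ ℓ ^ 2 := by nlinarith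
      have h3 : B' * L ≤ B' * (2 * (k + 1) * ℓ) := mul_le_mul_of_nonneg_left hLt hB'
      have h4 : B' * (2 * (k + 1) * ℓ) ≤ B' * (2 * (k + 1) * ℓ ^ 2) := by gcongr
      have h5 : B * (ℓ ^ 2 + 2 * ℓ) ≤ B * (ℓ ^ 2 + 2 * ℓ ^ 2) := by gcongr
      linarith
    calc |x * (σ' φt * (-L / (t * ℓ ^ 2))) * (t * ℓ ^ 2) - x * σ φt * (ℓ ^ 2 + 2 * ℓ)| *
          (t ^ 2 * ℓ ^ 2)
        ≤ x * (B' * L + B * (ℓ ^ 2 + 2 * ℓ)) * (t ^ 2 * ℓ ^ 2) := by gcongr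
      _ ≤ ((B + 1) * x) * ((2 * (k + 1) * B' + 3 * B) * ℓ ^ 2) * (t ^ 2 * ℓ ^ 2) := by gcongr
      _ = (2 * (k + 1) * B' + 3 * B) * ((B + 1) * x) * (t * ℓ ^ 2) ^ 2 := by ring
  have hres := abs_sum_sub_integral_le_of_weight_bounds hC₀ hE ha hab hba (by positivity)
    (by positivity) hf hf'c hfb hf'b
  -- the prime sum is the one in the statement
  have hsum : ∑ p ∈ (Finset.Ioc ⌊a⌋₊ ⌊b⌋₊).filter Nat.Prime, f p * Real.log p =
      ∑ p ∈ (Finset.Ioc ⌊a⌋₊ ⌊b⌋₊).filter Nat.Prime,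
        x * σ (Real.log x / Real.log p - 1) / (p * Real.log p) := by
    refine Finset.sum_congr rfl fun p hp => ?_
    have hp2 := (Finset.mem_filter.mp hp).2.two_le
    have hlp : Real.log p ≠ 0 := (Real.log_pos (by exact_mod_cast hp2)).ne'
    have hp0 : (p : ℝ) ≠ 0 := by positivity
    rw [hf_def]
    simp only
    field_simp
  rw [hsum] at hres
  exact hres

/-! ### The main sum -/

/-- **The main sum of the Buchstab iteration for a general `C¹` weight.** For `k ≥ 2`,
`e ≤ a ≤ y ≤ a + 1`, `a ≤ b < z ≤ b + 1`, `y ≤ z`, `log z = (log x)/k`, `k ≤ u = log x/log y`,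
`log x ≤ 2(k + 1) log a`, `log b ≤ 3 log a`, `x ≥ 1`, `|ϑ(t) − t| ≤ C₀ t/log² t` (`t ≥ 2`), and a
weight `σ` continuous on `[k − 1, 2k + 1]` with `|σ| ≤ B` there, differentiable with continuous
derivative `σ'`, `|σ'| ≤ B'`, on `(k − 1, 2k + 1]` (`B, B' ≥ 0`):
`|∑_{⌊a⌋ < p ≤ ⌊b⌋} x σ(log x/log p − 1)/(p log p) − (x/log x) ∫_{k−1}^{u−1} σ(s) ds|`
`≤ ((2 + 3(2(k + 1)B' + 3B)) C₀ (B + 1) + 2B) x/log² a`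
(`abs_sum_weight_sub_integral_le` on `[a, b]`; the integral is moved to `[y, z]` at the cost
`2B x/(a log² a)`, and evaluated by `integral_weight_comp_logRatio_eq`). For `σ = ω` this is the
main sum of Lichtman's Lemma 6.1 / Harman (1.4.14)–(1.4.16): "Partial summation as before then
gives … The change of variables `v = (log x)/(log y)` gives …".
[cite: Lichtman2025LinearSieve, Lemma 6.1] -/
theorem abs_sum_weight_sub_main_le {σ σ' : ℝ → ℝ} {k : ℕ} (hk : 2 ≤ k) {x y z a b C₀ B B' : ℝ}
    (hC₀ : 0 ≤ C₀) (hE : ∀ t : ℝ, 2 ≤ t → |θ t - t| ≤ C₀ * t / Real.log t ^ 2)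
    (ha : Real.exp 1 ≤ a) (hay : a ≤ y) (hya : y ≤ a + 1) (hab : a ≤ b) (hbz : b < z)
    (hzb : z ≤ b + 1) (hyz : y ≤ z) (hz : Real.log z = Real.log x / k)
    (hu : (k : ℝ) ≤ Real.log x / Real.log y) (hxa : Real.log x ≤ 2 * (k + 1) * Real.log a)
    (hba : Real.log b ≤ 3 * Real.log a) (hx : 1 ≤ x) (hB : 0 ≤ B) (hB' : 0 ≤ B')
    (hσc : ContinuousOn σ (Set.Icc ((k : ℝ) - 1) (2 * k + 1)))
    (hσ : ∀ s : ℝ, (k : ℝ) - 1 < s → s ≤ 2 * k + 1 → HasDerivAt σ (σ' s) s)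
    (hσ'c : ContinuousOn σ' (Set.Ioc ((k : ℝ) - 1) (2 * k + 1)))
    (hσb : ∀ s : ℝ, (k : ℝ) - 1 ≤ s → s ≤ 2 * k + 1 → |σ s| ≤ B)
    (hσ'b : ∀ s : ℝ, (k : ℝ) - 1 < s → s ≤ 2 * k + 1 → |σ' s| ≤ B') :
    |∑ p ∈ (Finset.Ioc ⌊a⌋₊ ⌊b⌋₊).filter Nat.Prime,
        x * σ (Real.log x / Real.log p - 1) / (p * Real.log p) -
      x / Real.log x * ∫ s in ((k : ℝ) - 1)..(Real.log x / Real.log y - 1), σ s| ≤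
      ((2 + 3 * (2 * (k + 1) * B' + 3 * B)) * C₀ * (B + 1) + 2 * B) * x / Real.log a ^ 2 := by
  -- numerics
  have hk0 : (0 : ℝ) < k := by positivity
  have ha0 : 0 < a := (Real.exp_pos 1).trans_le ha
  have hla : 1 ≤ Real.log a := by rw [Real.le_log_iff_exp_le ha0]; exact ha
  have ha1 : 1 < a := lt_of_lt_of_le (by linarith [Real.add_one_le_exp (1 : ℝ)]) ha
  have hy1 : 1 < y := ha1.trans_le hay
  have hb0 : 0 < b := ha0.trans_le hab
  have hx0 : 0 ≤ x := by linarith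
  have hkb : k * Real.log b < Real.log x := by
    calc (k : ℝ) * Real.log b < k * Real.log z :=
          mul_lt_mul_of_pos_left (Real.log_lt_log hb0 hbz) hk0
      _ = Real.log x := by rw [hz]; field_simp
  -- on `[a, z]`: `t > 1`, `log t ≥ log a`, `k − 1 ≤ log x/log t − 1 ≤ 2k + 1`
  have hmem : ∀ t ∈ Icc a z, 1 < t ∧ Real.log a ≤ Real.log t ∧
      (k : ℝ) - 1 ≤ Real.log x / Real.log t - 1 ∧ Real.log x / Real.log t - 1 ≤ 2 * k + 1 := by
    intro t ht
    have ht1 : 1 < t := ha1.trans_le ht.1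
    have hlt : 0 < Real.log t := Real.log_pos ht1
    have hlat : Real.log a ≤ Real.log t := Real.log_le_log ha0 ht.1
    refine ⟨ht1, hlat, ?_, ?_⟩
    · have hz1 : Real.log t ≤ Real.log z := Real.log_le_log (by linarith) ht.2
      have : (k : ℝ) ≤ Real.log x / Real.log t := by
        rw [le_div_iff₀ hlt]
        calc (k : ℝ) * Real.log t ≤ k * Real.log z := by gcongr
          _ = Real.log x := by rw [hz]; field_simp
      linarith
    · rw [sub_le_iff_le_add, div_le_iff₀ hlt]
      calc Real.log x ≤ 2 * (k + 1) * Real.log a := hxa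
        _ ≤ 2 * (k + 1) * Real.log t := by gcongr
        _ = (2 * k + 1 + 1) * Real.log t := by ring
  -- the main term (`u − 1 ≤ 2k + 1` as `y ∈ [a, z]`) and the prime-sum estimate on `[a, b]`
  have hmainTerm := integral_weight_comp_logRatio_eq hk0 hy1 hyz hz hu
    (hσc.mono (Set.Icc_subset_Icc_right (hmem y ⟨hay, hyz⟩).2.2.2))
  have hflav := abs_sum_weight_sub_integral_le hC₀ hE ha hab hkb hxa hba hx0 hB hB' hσ hσ'c
    (fun s hs1 hs2 => hσb s hs1.le hs2) hσ'b
  -- the weight `g` and its sup bound `B x/log² a` on `[a, z]`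
  set g : ℝ → ℝ := fun t => x * σ (Real.log x / Real.log t - 1) / (t * Real.log t ^ 2)
    with hg_def
  have hgc : ContinuousOn g (Icc a z) := by
    intro t ht
    obtain ⟨ht1, hlat, hφ1, hφ2⟩ := hmem t ht
    have h1 : t ≠ 0 := by positivity
    have hl0 : Real.log t ≠ 0 := by linarith
    have h2 : t * Real.log t ^ 2 ≠ 0 := mul_ne_zero h1 (pow_ne_zero 2 hl0)
    have hφc : ContinuousAt (fun s : ℝ => Real.log x / Real.log s - 1) t := by
      fun_prop (disch := assumption)
    have hA : ContinuousWithinAt (fun s : ℝ => σ (Real.log x / Real.log s - 1)) (Icc a z) t :=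
      (hσc _ ⟨hφ1, hφ2⟩).comp (f := fun s : ℝ => Real.log x / Real.log s - 1)
        hφc.continuousWithinAt fun s hs => ⟨(hmem s hs).2.2.1, (hmem s hs).2.2.2⟩
    have hD : ContinuousAt (fun s : ℝ => s * Real.log s ^ 2) t := by
      fun_prop (disch := assumption)
    rw [hg_def]
    exact (continuousWithinAt_const.mul hA).div hD.continuousWithinAt h2
  have hgB : ∀ t ∈ Icc a z, |g t| ≤ B * x / Real.log a ^ 2 := by
    intro t ht
    obtain ⟨ht1, hlat, hφ1, hφ2⟩ := hmem t ht
    have hlt : 1 ≤ Real.log t := hla.trans hlat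
    have hσle := hσb _ hφ1 hφ2
    rw [hg_def]
    simp only
    rw [abs_div, abs_mul, abs_of_nonneg hx0, abs_of_pos (by positivity : 0 < t * Real.log t ^ 2)]
    calc x * |σ (Real.log x / Real.log t - 1)| / (t * Real.log t ^ 2)
        ≤ x * B / (t * Real.log t ^ 2) := by gcongr
      _ ≤ x * B / (1 * Real.log a ^ 2) := by
          apply div_le_div_of_nonneg_left (by positivity) (by positivity)
          exact mul_le_mul (ha1.le.trans ht.1) (pow_le_pow_left₀ (by linarith) hlat 2)
            (by positivity) (by linarith)
      _ = B * x / Real.log a ^ 2 := by rw [one_mul, mul_comm x B]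
  have hmove := abs_integral_sub_integral_le_two_mul_of_shift hay hya hab hbz.le hzb hyz hgc hgB
  rw [← hmainTerm]
  have htri := abs_sub_le
    (∑ p ∈ (Finset.Ioc ⌊a⌋₊ ⌊b⌋₊).filter Nat.Prime,
      x * σ (Real.log x / Real.log p - 1) / (p * Real.log p))
    (∫ t in a..b, g t) (∫ t in y..z, g t)
  calc _ ≤ (2 + 3 * (2 * (k + 1) * B' + 3 * B)) * C₀ * ((B + 1) * x) / Real.log a ^ 2 +
        2 * (B * x / Real.log a ^ 2) := by linarith
    _ = ((2 + 3 * (2 * (k + 1) * B' + 3 * B)) * C₀ * (B + 1) + 2 * B) * x / Real.log a ^ 2 := by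
        ring

end Literature.NumberTheory.Sieve
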